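import Literature.NumberTheory.GelbartRogawski1991.LocalDoubledInvariantFunctional
import HarnessLib

-- buildfix G11b-3 recipe (LEDGER B13-1/B13-3), as in the GelbartRogawski1991 siblings: elaborate sequentially.
set_option Elab.async false

/-!
# The `P_Δ ∖ U(W ⊕ −W)`-integral of the orbit coefficients of an `inl U(W)`-fixed vector: a `U(W ⊕ −W)`-INVARIANT linear
# functional, non-zero on the fixed vector (the dock of the SOFT road to rank-one theta dichotomy)

Topic `NumberTheory/GelbartRogawski1991`; namespace `Literature.NumberTheory.GelbartRogawski1991.UnitaryDualPair.LocalSplitting`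
(sequel of ★ `LocalDoubledInvariantFunctional` ∕ ★ `LocalDoubledAnisotropicFactorisation`).  KERNEL MATHEMATICS ONLY: theorems, no definition,
no named fact, no instance, no notation, no `sorry`.  Cell `hodgecm-mathlib` (D-0151), line LD2, in-house payer road of the rank-one organ
`LineThetaTypesComplementary₁`, SOFT road (π3), brick **(O2) «(π3) DENSITY GLUE ∕ INVARIANT FUNCTIONAL OF A FIXED VECTOR»** (LD2-plan (g3)
DEALS #12 (3), 2026-09-02; seat A-p19 (g31)).  ABSTRACT OVER THE SECTION: the Weil-representation data enter only as a map `σ` from the group to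
linear endomorphisms of a complex vector space `V` and a linear functional `lam` on `V` with the stated multiplicativity ∕ eigen ∕ fixed-vector
properties, so that the twisted section (TW) and the Kronecker embedding (K) dock by instantiation.

SETTING.  `E/F` quadratic, `c`, `δ`; `v` a finite place of `F`, NON-SPLIT (`hE : E ⊗ F_v` is a field); `T₁ ∈ M_1(F)` an invertible hermitian LINE
`W`, `J₁ = T₁ ⊗ 1`, `J^𝔻 = (T₁ ⊕ −T₁) ⊗ 1`; `G₁ := H(F_v) = U(W ⊕ −W)(F_v) = localPi E c (1+1) JD₁ v`; `inl := inlLoc : U(W)(F_v) →* G₁`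
(`g ↦ g ⊕ 1`, ★ `LocalUnitaryUndoubling`); `P ≤ G₁` a subgroup with `h ∈ P ↔ IsSiegelDelta h` (a bundled copy of the Siegel parabolic `P_Δ`;
locally compact ★ `locallyCompactSpace_of_isSiegelDelta`); `Δ_P = ` Mathlib's `modularCharacter` of `↥P` (= `‖det_Δ‖`, ★
`LocalDoubledSiegelParabolicModularCharacter` ∕ ★ `…BorelTransport`).  DATA: `σ : G₁ → (V →ₗ[ℂ] V)`, `lam : V →ₗ[ℂ] ℂ`, `Φ ∈ V`, `r ∈ ℝ`, with
(mult) `σ (p h) = σ p ∘ σ h` for `p ∈ P_Δ` (pointwise), (eigen) `lam (σ p Ψ) = Δ_P(p) · lam Ψ` for `p ∈ P`, (fix) `σ (inl u) Φ = Φ`,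
(val) `lam Φ = r > 0`.

MATHEMATICS ([GelbartPiatetskishapiroRallis1987, Part A §2 Lemma 2.1]: `H = P · (U(W) × 1)` with `P ∩ (U(W) × 1)` trivial for anisotropic `W`;
[WeilIntegration1965, §9]: the invariant integral on `P ∖ H` of `Δ_P`-densities).  By the UNIQUE factorisation `h = p · inl u` (★
`existsUnique_isSiegelDelta_mul_inlLoc_inv_of_rank_one`) the ORBIT COEFFICIENT `F_Φ(h) := lam (σ h Φ)` equals `Δ_P(p) · r` (§1
`exists_orbitCoeff_eq`): so `F_Φ (p h) = Δ_P(p) F_Φ(h)` (`orbitCoeff_left`), `F_Φ (h · inl u) = F_Φ(h)` (`orbitCoeff_mul_inlLoc`), and `F_Φ` is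
REAL, `> 0` EVERYWHERE (`orbitCoeff_re`, `orbitCoeff_re_nonneg_ne_zero`; `Δ_P > 0` is Mathlib `modularCharacterFun_pos`).  §2 (abstract, any
topological group `G`, any weight `wt` on a type `Q → G`): an «invariant functional» `I` with the four clauses of ★
`exists_rightInvariant_functional_of_isSiegelDelta` (additive + homogeneous on continuous functions, `I (f (· h)) = I f` on continuous
left-`wt`-equivariant `f`, `0 < re I f` on such `f ≥ 0` with `f x₀ ≠ 0`) and a FULLY multiplicative `σ` with continuous coefficients
`h ↦ lam (σ h Ψ)` give the LINEAR functional `Λ Ψ := I (h ↦ lam (σ h Ψ))` with **`Λ (σ g Ψ) = Λ Ψ` for all `g ∈ G`** and **`0 < re Λ Φ`**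
(`exists_invariant_functional_of_functional`).  §3 THE DOCK `exists_invariant_functional_of_fixedVector` (generic `E/F`, a Haar `μ` on `G₁`
that is right invariant) and §4 `…_cm` (CM tokens `F = L⁺`, `E = L`, `c = c̄`, `δ = imagUnit L`; NO measure-theoretic binder: `borelize` +
Mathlib `Measure.haar` + ★ `isMulRightInvariant_localPi_gramD_one`; `[LocallyCompactSpace ↥P]` discharged in the statement):
**`∃ Λ : V →ₗ[ℂ] ℂ, (∀ g Ψ, Λ (σ g Ψ) = Λ Ψ) ∧ 0 < (Λ Φ).re`** — «a `U(W ⊕ −W)(F_v)`-INVARIANT functional on `V`, non-zero on `Φ`».  In the (π3)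
assembly (LD2-plan (g2) RULING (β) (5)) `V = 𝒮(L⁺_v^{2+2})`, `σ = s′` the twisted doubled Weil section through the Kronecker embedding, `lam =
λ′ = ev₀ ∘ ω^𝔻(m₀ …)`, `Φ = f₁ ⊠ f₂`; the kernel lemmas ★ (S1) `functional_apply_eq_zero_of_forall_unipOpPi_eq` + ★ (S2) then force `Λ = 0`,
the contradiction proving the pin (P).
HONEST LABEL: HC_CM is proved only modulo the 7 printed citations (2 remaining named inputs hLiu418, h413) until rung 0 closes; this file
discharges no named fact and is count-neutral.

## References
* [GelbartPiatetskishapiroRallis1987] S. Gelbart, I. Piatetski-Shapiro, S. Rallis, *Explicit Constructions of Automorphic L-Functions*, LNM 1254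
  (1987), Part A §2 Lemma 2.1 p. 8 (`P ∖ H` and the embedded `G × 1`).
* [WeilIntegration1965] A. Weil, *L'intégration dans les groupes topologiques et ses applications*, 2e éd. (1965), §9 (relatively invariant
  measures on homogeneous spaces `G ∕ P`, the `Δ_P`-densities).
* [Kudla1994] S. S. Kudla, Israel J. Math. 87 (1994), §3 (the Siegel parabolic `P_Y`, its character).
* [HarrisKudlaSweet1996] M. Harris, S. S. Kudla, W. J. Sweet, J. Amer. Math. Soc. 9 (1996), §1 (1.11) (the doubled space, `Δ`, `P_Δ`).
* [Rogawski1990] J. D. Rogawski, Ann. of Math. Stud. 123 (1990), §4.9 p. 54 (Haar measures on the local unitary groups).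
-/

set_option autoImplicit false

noncomputable section

open NumberField IsDedekindDomain MeasureTheory MeasureTheory.Measure
open scoped NNReal
open Literature.NumberTheory.Automorphic Literature.NumberTheory.Automorphic.UnitaryGroup

namespace Literature.NumberTheory.GelbartRogawski1991.UnitaryDualPair.LocalSplitting

/-! ## §1 The orbit coefficient `h ↦ λ(σ(h) Φ)` of an `inl U(W)`-fixed vector with a `Δ_P`-eigenfunctional -/

section Density

variable (F : Type) [Field F] [NumberField F] (E : Type) [Field E] [NumberField E] [Algebra F E]
  [Algebra.IsQuadraticExtension F E] (c : E ≃ₐ[F] E)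
  {δ : E} (hcδ : c δ = -δ) (hδ : δ ≠ 0) {d : F} (hd : δ * δ = algebraMap F E d)
  (v : HeightOneSpectrum (𝓞 F)) {T₁ : Matrix (Fin 1) (Fin 1) F} (hT₁ : T₁.IsSymm) (hT₁d : IsUnit T₁.det)
  {J₁ : Matrix (Fin 1) (Fin 1) E} (hJ₁ : J₁ = T₁.map (algebraMap F E))
  {JD₁ : Matrix (Fin (1 + 1)) (Fin (1 + 1)) E} (hJD₁ : JD₁ = (gramD F 1 T₁).map (algebraMap F E))
  (P : Subgroup (UnitaryGroup.localPi E c (1 + 1) JD₁ v))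
  (hP : ∀ h, h ∈ P ↔ IsSiegelDelta F E c hcδ hδ hd v 1 hT₁ hJD₁ h)
  {V : Type*} [AddCommGroup V] [Module ℂ V]
  (σ : UnitaryGroup.localPi E c (1 + 1) JD₁ v → V →ₗ[ℂ] V) (lam : V →ₗ[ℂ] ℂ) (Φ : V) (r : ℝ)

include hP in
/-- **left `Δ_P`-equivariance of every orbit coefficient**: `lam (σ (p h) Ψ) = Δ_P(p) · lam (σ h Ψ)` for `p ∈ P`, any `Ψ` ((mult) on `P_Δ` +
(eigen)). [cite: Kudla1994, §3] [cite: WeilIntegration1965, §9] -/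
theorem orbitCoeff_left [LocallyCompactSpace P]
    (hσP : ∀ p, IsSiegelDelta F E c hcδ hδ hd v 1 hT₁ hJD₁ p → ∀ h Ψ, σ (p * h) Ψ = σ p (σ h Ψ))
    (hlam : ∀ (p : P) (Ψ : V), lam (σ p Ψ) = ((modularCharacter p : ℝ) : ℂ) * lam Ψ)
    (Ψ : V) (p : P) (h : UnitaryGroup.localPi E c (1 + 1) JD₁ v) :
    lam (σ ((p : UnitaryGroup.localPi E c (1 + 1) JD₁ v) * h) Ψ) = ((modularCharacter p : ℝ) : ℂ) * lam (σ h Ψ) := by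
  rw [hσP _ ((hP _).1 p.2), hlam]

include hP in
/-- **the orbit coefficient of the fixed vector on `P · inl U(W)`**: `lam (σ (p · inl u) Φ) = Δ_P(p) · r`.
[cite: GelbartPiatetskishapiroRallis1987, Part A §2 Lemma 2.1 p. 8] [cite: Kudla1994, §3] -/
theorem orbitCoeff_mul_inlLoc_eq [LocallyCompactSpace P]
    (hσP : ∀ p, IsSiegelDelta F E c hcδ hδ hd v 1 hT₁ hJD₁ p → ∀ h Ψ, σ (p * h) Ψ = σ p (σ h Ψ))
    (hlam : ∀ (p : P) (Ψ : V), lam (σ p Ψ) = ((modularCharacter p : ℝ) : ℂ) * lam Ψ)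
    (hfix : ∀ u, σ (inlLoc F E c v 1 hJ₁ hJD₁ u) Φ = Φ) (hΦ : lam Φ = (r : ℂ))
    (p : P) (u : UnitaryGroup.localPi E c 1 J₁ v) :
    lam (σ ((p : UnitaryGroup.localPi E c (1 + 1) JD₁ v) * inlLoc F E c v 1 hJ₁ hJD₁ u) Φ) =
      ((modularCharacter p : ℝ) : ℂ) * r := by
  rw [orbitCoeff_left F E c hcδ hδ hd v hT₁ hJD₁ P hP σ lam hσP hlam, hfix, hΦ]

include hcδ hδ hd hT₁d hJ₁ hP in
/-- **the orbit coefficient of the fixed vector EVERYWHERE** (`v` non-split, rank one): every `h ∈ U(W ⊕ −W)(F_v)` is `p · inl u` with `p ∈ P`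
(★ `existsUnique_isSiegelDelta_mul_inlLoc_inv_of_rank_one`) and `lam (σ h Φ) = Δ_P(p) · r`.
[cite: GelbartPiatetskishapiroRallis1987, Part A §2 Lemma 2.1 p. 8] [cite: Kudla1994, §3] -/
theorem exists_orbitCoeff_eq [LocallyCompactSpace P] (hE : IsField (LocalRing E v))
    (hσP : ∀ p, IsSiegelDelta F E c hcδ hδ hd v 1 hT₁ hJD₁ p → ∀ h Ψ, σ (p * h) Ψ = σ p (σ h Ψ))
    (hlam : ∀ (p : P) (Ψ : V), lam (σ p Ψ) = ((modularCharacter p : ℝ) : ℂ) * lam Ψ)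
    (hfix : ∀ u, σ (inlLoc F E c v 1 hJ₁ hJD₁ u) Φ = Φ) (hΦ : lam Φ = (r : ℂ))
    (h : UnitaryGroup.localPi E c (1 + 1) JD₁ v) :
    ∃ (p : P) (u : UnitaryGroup.localPi E c 1 J₁ v),
      h = (p : UnitaryGroup.localPi E c (1 + 1) JD₁ v) * inlLoc F E c v 1 hJ₁ hJD₁ u ∧
      lam (σ h Φ) = ((modularCharacter p : ℝ) : ℂ) * r := by
  obtain ⟨u, hu, -⟩ := existsUnique_isSiegelDelta_mul_inlLoc_inv_of_rank_one F E c hcδ hδ hd v hE hT₁ hT₁d hJ₁ hJD₁ h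
  let p : P := ⟨h * (inlLoc F E c v 1 hJ₁ hJD₁ u)⁻¹, (hP _).2 hu⟩
  have hp : (p : UnitaryGroup.localPi E c (1 + 1) JD₁ v) = h * (inlLoc F E c v 1 hJ₁ hJD₁ u)⁻¹ := rfl
  have hh : h = (p : UnitaryGroup.localPi E c (1 + 1) JD₁ v) * inlLoc F E c v 1 hJ₁ hJD₁ u := by
    rw [hp, inv_mul_cancel_right]
  refine ⟨p, u, hh, ?_⟩
  have key := orbitCoeff_mul_inlLoc_eq F E c hcδ hδ hd v hT₁ hJ₁ hJD₁ P hP σ lam Φ r hσP hlam hfix hΦ p u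
  rw [← hh] at key
  exact key

include hcδ hδ hd hT₁d hJ₁ hP in
/-- **right `inl U(W)`-invariance of the orbit coefficient of the fixed vector**: `lam (σ (h · inl u) Φ) = lam (σ h Φ)` — although `σ` is only
assumed multiplicative along `P_Δ` on the left (the factorisation `h = p · inl u₀` moves `inl u` into the fixed vector).
[cite: GelbartPiatetskishapiroRallis1987, Part A §2 Lemma 2.1 p. 8] -/
theorem orbitCoeff_mul_inlLoc [LocallyCompactSpace P] (hE : IsField (LocalRing E v))
    (hσP : ∀ p, IsSiegelDelta F E c hcδ hδ hd v 1 hT₁ hJD₁ p → ∀ h Ψ, σ (p * h) Ψ = σ p (σ h Ψ))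
    (hlam : ∀ (p : P) (Ψ : V), lam (σ p Ψ) = ((modularCharacter p : ℝ) : ℂ) * lam Ψ)
    (hfix : ∀ u, σ (inlLoc F E c v 1 hJ₁ hJD₁ u) Φ = Φ) (hΦ : lam Φ = (r : ℂ))
    (h : UnitaryGroup.localPi E c (1 + 1) JD₁ v) (u : UnitaryGroup.localPi E c 1 J₁ v) :
    lam (σ (h * inlLoc F E c v 1 hJ₁ hJD₁ u) Φ) = lam (σ h Φ) := by
  obtain ⟨p, u₀, rfl, hval⟩ := exists_orbitCoeff_eq F E c hcδ hδ hd v hT₁ hT₁d hJ₁ hJD₁ P hP σ lam Φ r hE hσP hlam hfix hΦ h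
  rw [hval, mul_assoc, ← map_mul, orbitCoeff_mul_inlLoc_eq F E c hcδ hδ hd v hT₁ hJ₁ hJD₁ P hP σ lam Φ r hσP hlam hfix hΦ]

include hcδ hδ hd hT₁d hJ₁ hP in
/-- **the orbit coefficient of the fixed vector is REAL and `> 0` everywhere** (`= Δ_P(p) · r`, `Δ_P > 0` Mathlib `modularCharacterFun_pos`,
`r > 0`). [cite: GelbartPiatetskishapiroRallis1987, Part A §2 Lemma 2.1 p. 8] [cite: WeilIntegration1965, §9] -/
theorem orbitCoeff_re [LocallyCompactSpace P] (hE : IsField (LocalRing E v))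
    (hσP : ∀ p, IsSiegelDelta F E c hcδ hδ hd v 1 hT₁ hJD₁ p → ∀ h Ψ, σ (p * h) Ψ = σ p (σ h Ψ))
    (hlam : ∀ (p : P) (Ψ : V), lam (σ p Ψ) = ((modularCharacter p : ℝ) : ℂ) * lam Ψ)
    (hfix : ∀ u, σ (inlLoc F E c v 1 hJ₁ hJD₁ u) Φ = Φ) (hΦ : lam Φ = (r : ℂ)) (hr : 0 < r)
    (h : UnitaryGroup.localPi E c (1 + 1) JD₁ v) :
    lam (σ h Φ) = ((lam (σ h Φ)).re : ℂ) ∧ 0 < (lam (σ h Φ)).re := by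
  obtain ⟨p, u, -, hval⟩ := exists_orbitCoeff_eq F E c hcδ hδ hd v hT₁ hT₁d hJ₁ hJD₁ P hP σ lam Φ r hE hσP hlam hfix hΦ h
  have hpos : 0 < (modularCharacter (p : P) : ℝ) := NNReal.coe_pos.2 (modularCharacterFun_pos (p : P))
  rw [hval, ← Complex.ofReal_mul, Complex.ofReal_re]
  exact ⟨rfl, mul_pos hpos hr⟩

include hcδ hδ hd hT₁d hJ₁ hP in
/-- the same in the currency of ★ `exists_rightInvariant_functional_of_isSiegelDelta`'s positivity clause: the orbit coefficient is
`((·).re : ℂ)`-valued with `0 ≤ re`, and `≠ 0` everywhere. [cite: GelbartPiatetskishapiroRallis1987, Part A §2 Lemma 2.1 p. 8] [cite: WeilIntegration1965, §9] -/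
theorem orbitCoeff_re_nonneg_ne_zero [LocallyCompactSpace P] (hE : IsField (LocalRing E v))
    (hσP : ∀ p, IsSiegelDelta F E c hcδ hδ hd v 1 hT₁ hJD₁ p → ∀ h Ψ, σ (p * h) Ψ = σ p (σ h Ψ))
    (hlam : ∀ (p : P) (Ψ : V), lam (σ p Ψ) = ((modularCharacter p : ℝ) : ℂ) * lam Ψ)
    (hfix : ∀ u, σ (inlLoc F E c v 1 hJ₁ hJD₁ u) Φ = Φ) (hΦ : lam Φ = (r : ℂ)) (hr : 0 < r) :
    (∀ h : UnitaryGroup.localPi E c (1 + 1) JD₁ v, lam (σ h Φ) = ((lam (σ h Φ)).re : ℂ) ∧ 0 ≤ (lam (σ h Φ)).re) ∧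
      ∀ h : UnitaryGroup.localPi E c (1 + 1) JD₁ v, lam (σ h Φ) ≠ 0 := by
  refine ⟨fun h => ?_, fun h h0 => ?_⟩
  · obtain ⟨h1, h2⟩ := orbitCoeff_re F E c hcδ hδ hd v hT₁ hT₁d hJ₁ hJD₁ P hP σ lam Φ r hE hσP hlam hfix hΦ hr h
    exact ⟨h1, h2.le⟩
  · have h2 := (orbitCoeff_re F E c hcδ hδ hd v hT₁ hT₁d hJ₁ hJD₁ P hP σ lam Φ r hE hσP hlam hfix hΦ hr h).2
    rw [h0, Complex.zero_re] at h2
    exact lt_irrefl _ h2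

end Density

/-! ## §2 The invariant functional `Λ(Ψ) = ∮_{P_Δ \ G₁} λ(σ(h) Ψ)` is `G₁`-invariant and non-zero -/

section Functional

variable (F : Type) [Field F] [NumberField F] (E : Type) [Field E] [NumberField E] [Algebra F E]
  [Algebra.IsQuadraticExtension F E] (c : E ≃ₐ[F] E)
  {δ : E} (hcδ : c δ = -δ) (hδ : δ ≠ 0) {d : F} (hd : δ * δ = algebraMap F E d)
  (v : HeightOneSpectrum (𝓞 F)) {T₁ : Matrix (Fin 1) (Fin 1) F} (hT₁ : T₁.IsSymm) (hT₁d : IsUnit T₁.det)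
  {J₁ : Matrix (Fin 1) (Fin 1) E} (hJ₁ : J₁ = T₁.map (algebraMap F E))
  {JD₁ : Matrix (Fin (1 + 1)) (Fin (1 + 1)) E} (hJD₁ : JD₁ = (gramD F 1 T₁).map (algebraMap F E))

/-- **ABSTRACT ASSEMBLY** (any topological group `G`, any «weight» `wt : Q → ℂ` on a family `coeQ : Q → G`): an «invariant functional» `I`
on functions `G → ℂ` — additive and homogeneous on continuous functions, `I (f (· h)) = I f` on continuous left-`wt`-equivariant `f`
(`f (q x) = wt q · f x`), `0 < re (I f)` on such `f` real `≥ 0` with some `f x₀ ≠ 0` (the four clauses of ★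
`WeilBruhat.exists_rightInvariant_functional`) — together with a FULLY multiplicative `σ : G → (V →ₗ[ℂ] V)`, a linear `lam` with the
eigen-law `lam (σ q Ψ) = wt q · lam Ψ` and continuous coefficients `h ↦ lam (σ h Ψ)`, yields the LINEAR functional
`Λ Ψ := I (h ↦ lam (σ h Ψ))` with `Λ (σ g Ψ) = Λ Ψ` (all `g`) and `0 < re (Λ Φ)` for any `Φ` whose coefficient is real `≥ 0` and `≠ 0` at `1`.
[cite: WeilIntegration1965, §9] -/
theorem exists_invariant_functional_of_functional
    {G : Type*} [Group G] [TopologicalSpace G] {Q : Type*} (coeQ : Q → G) (wt : Q → ℂ)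
    (I : (G → ℂ) → ℂ)
    (hIadd : ∀ f g : G → ℂ, Continuous f → Continuous g → I (f + g) = I f + I g)
    (hIsmul : ∀ (a : ℂ) (f : G → ℂ), I (a • f) = a * I f)
    (hIinv : ∀ f : G → ℂ, Continuous f → (∀ (p : Q) (x : G), f (coeQ p * x) = wt p * f x) → ∀ h : G, I (fun x => f (x * h)) = I f)
    (hIpos : ∀ f : G → ℂ, Continuous f → (∀ (p : Q) (x : G), f (coeQ p * x) = wt p * f x) →
      (∀ x, f x = ((f x).re : ℂ) ∧ 0 ≤ (f x).re) → ∀ x₀, f x₀ ≠ 0 → 0 < (I f).re)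
    {V : Type*} [AddCommGroup V] [Module ℂ V] (σ : G → V →ₗ[ℂ] V) (lam : V →ₗ[ℂ] ℂ)
    (hσ : ∀ g h Ψ, σ (g * h) Ψ = σ g (σ h Ψ))
    (hlam : ∀ (p : Q) (Ψ : V), lam (σ (coeQ p) Ψ) = wt p * lam Ψ)
    (hcont : ∀ Ψ, Continuous fun h => lam (σ h Ψ))
    (Φ : V) (hre : ∀ h, lam (σ h Φ) = ((lam (σ h Φ)).re : ℂ) ∧ 0 ≤ (lam (σ h Φ)).re) (hne : lam (σ 1 Φ) ≠ 0) :
    ∃ Λ : V →ₗ[ℂ] ℂ, (∀ g Ψ, Λ (σ g Ψ) = Λ Ψ) ∧ 0 < (Λ Φ).re := by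
  have hdens : ∀ Ψ (p : Q) (x : G), lam (σ (coeQ p * x) Ψ) = wt p * lam (σ x Ψ) := fun Ψ p x => by
    rw [hσ, hlam]
  refine ⟨{ toFun := fun Ψ => I (fun h => lam (σ h Ψ))
            map_add' := fun Ψ₁ Ψ₂ => ?_
            map_smul' := fun a Ψ => ?_ }, fun g Ψ => ?_, ?_⟩
  · have : (fun h => lam (σ h (Ψ₁ + Ψ₂))) = (fun h => lam (σ h Ψ₁)) + fun h => lam (σ h Ψ₂) := by
      funext h; simp only [map_add, Pi.add_apply]
    rw [this, hIadd _ _ (hcont Ψ₁) (hcont Ψ₂)]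
  · have : (fun h => lam (σ h (a • Ψ))) = a • fun h => lam (σ h Ψ) := by
      funext h; simp only [map_smul, smul_eq_mul, Pi.smul_apply]
    rw [this, hIsmul, RingHom.id_apply, smul_eq_mul]
  · show I (fun h => lam (σ h (σ g Ψ))) = I (fun h => lam (σ h Ψ))
    have : (fun h => lam (σ h (σ g Ψ))) = fun h => lam (σ (h * g) Ψ) := by
      funext h; rw [hσ]
    rw [this]
    exact hIinv (fun h => lam (σ h Ψ)) (hcont Ψ) (hdens Ψ) g
  · exact hIpos (fun h => lam (σ h Φ)) (hcont Φ) (hdens Φ) hre 1 hne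

end Functional

/-! ## §3 The dock: a `G₁`-invariant linear functional, non-zero on the fixed vector -/

section Dock

variable (F : Type) [Field F] [NumberField F] (E : Type) [Field E] [NumberField E] [Algebra F E]
  [Algebra.IsQuadraticExtension F E] (c : E ≃ₐ[F] E)
  {δ : E} (hcδ : c δ = -δ) (hδ : δ ≠ 0) {d : F} (hd : δ * δ = algebraMap F E d)
  (v : HeightOneSpectrum (𝓞 F)) {T₁ : Matrix (Fin 1) (Fin 1) F} (hT₁ : T₁.IsSymm) (hT₁d : IsUnit T₁.det)
  {J₁ : Matrix (Fin 1) (Fin 1) E} (hJ₁ : J₁ = T₁.map (algebraMap F E))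
  {JD₁ : Matrix (Fin (1 + 1)) (Fin (1 + 1)) E} (hJD₁ : JD₁ = (gramD F 1 T₁).map (algebraMap F E))
  (P : Subgroup (UnitaryGroup.localPi E c (1 + 1) JD₁ v))
  (hP : ∀ h, h ∈ P ↔ IsSiegelDelta F E c hcδ hδ hd v 1 hT₁ hJD₁ h)
  {V : Type*} [AddCommGroup V] [Module ℂ V]
  (σ : UnitaryGroup.localPi E c (1 + 1) JD₁ v → V →ₗ[ℂ] V) (lam : V →ₗ[ℂ] ℂ) (Φ : V) (r : ℝ)

include hcδ hδ hd hT₁d hJ₁ hP in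
/-- **(O2) THE DOCK — an `inl U(W)`-FIXED VECTOR WITH A `Δ_{P_Δ}`-EIGENFUNCTIONAL YIELDS A NON-ZERO `U(W ⊕ −W)(F_v)`-INVARIANT LINEAR
FUNCTIONAL.**  Generic `E/F`, `v` non-split (`hE`), `U(W)(F_v)` compact, `μ` a Haar measure on `G₁ = U(W ⊕ −W)(F_v)` that is also right
invariant, `P` a bundled `P_Δ` (locally compact): for `σ : G₁ → (V →ₗ[ℂ] V)` multiplicative (pointwise), `lam : V →ₗ[ℂ] ℂ` with
`lam (σ p Ψ) = Δ_P(p) · lam Ψ` (`p ∈ P`), continuous coefficients `h ↦ lam (σ h Ψ)`, and `Φ` with `σ (inl u) Φ = Φ`, `lam Φ = r > 0`: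
**`∃ Λ : V →ₗ[ℂ] ℂ, (∀ g Ψ, Λ (σ g Ψ) = Λ Ψ) ∧ 0 < re (Λ Φ)`** — `Λ = ∮_{P ∖ G₁}` of the orbit coefficients (★
`exists_rightInvariant_functional_of_isSiegelDelta` + §1 + §2). [cite: WeilIntegration1965, §9] [cite: GelbartPiatetskishapiroRallis1987, Part A §2 Lemma 2.1 p. 8] -/
theorem exists_invariant_functional_of_fixedVector (hE : IsField (LocalRing E v))
    [CompactSpace (UnitaryGroup.localPi E c 1 J₁ v)]
    [MeasurableSpace (UnitaryGroup.localPi E c (1 + 1) JD₁ v)] [BorelSpace (UnitaryGroup.localPi E c (1 + 1) JD₁ v)]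
    (μ : Measure (UnitaryGroup.localPi E c (1 + 1) JD₁ v)) [μ.IsHaarMeasure] [μ.IsMulRightInvariant]
    [LocallyCompactSpace P]
    (hσ : ∀ g h Ψ, σ (g * h) Ψ = σ g (σ h Ψ))
    (hlam : ∀ (p : P) (Ψ : V), lam (σ p Ψ) = ((modularCharacter p : ℝ) : ℂ) * lam Ψ)
    (hcont : ∀ Ψ, Continuous fun h => lam (σ h Ψ))
    (hfix : ∀ u, σ (inlLoc F E c v 1 hJ₁ hJD₁ u) Φ = Φ) (hΦ : lam Φ = (r : ℂ)) (hr : 0 < r) :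
    ∃ Λ : V →ₗ[ℂ] ℂ, (∀ g Ψ, Λ (σ g Ψ) = Λ Ψ) ∧ 0 < (Λ Φ).re := by
  obtain ⟨I, hIadd, hIsmul, hIinv, hIpos⟩ :=
    exists_rightInvariant_functional_of_isSiegelDelta F E c hcδ hδ hd v hT₁ hT₁d hJ₁ hJD₁ hE μ P hP
  have hσP : ∀ p, IsSiegelDelta F E c hcδ hδ hd v 1 hT₁ hJD₁ p → ∀ h Ψ, σ (p * h) Ψ = σ p (σ h Ψ) :=
    fun p _ h Ψ => hσ p h Ψ
  obtain ⟨hre, hne⟩ :=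
    orbitCoeff_re_nonneg_ne_zero F E c hcδ hδ hd v hT₁ hT₁d hJ₁ hJD₁ P hP σ lam Φ r hE hσP hlam hfix hΦ hr
  exact exists_invariant_functional_of_functional (fun p : P => (p : UnitaryGroup.localPi E c (1 + 1) JD₁ v))
    (fun p : P => ((modularCharacter p : ℝ) : ℂ)) I hIadd hIsmul hIinv hIpos σ lam hσ hlam hcont Φ hre (hne 1)

end Dock

/-! ## §4 CM specialisation: `E/F = L/L⁺`, `c = c̄`, `δ = imagUnit L` — no measure-theoretic binders left -/

section CM

variable (L : Type) [Field L] [NumberField L] [IsCMField L] (v : HeightOneSpectrum (𝓞 ↥(maximalRealSubfield L)))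
  {T₁ : Matrix (Fin 1) (Fin 1) ↥(maximalRealSubfield L)} (hT₁ : T₁.IsSymm) (hT₁d : IsUnit T₁.det)
  {J₁ : Matrix (Fin 1) (Fin 1) L} (hJ₁ : J₁ = T₁.map (algebraMap (↥(maximalRealSubfield L)) L))
  {JD₁ : Matrix (Fin (1 + 1)) (Fin (1 + 1)) L}
  (hJD₁ : JD₁ = (gramD (↥(maximalRealSubfield L)) 1 T₁).map (algebraMap (↥(maximalRealSubfield L)) L))
  (P : Subgroup (UnitaryGroup.localPi L (IsCMField.complexConj L) (1 + 1) JD₁ v))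
  (hP : ∀ h, h ∈ P ↔ IsSiegelDelta (↥(maximalRealSubfield L)) L (IsCMField.complexConj L) (complexConj_imagUnit L)
    (imagUnit_ne_zero L) (imagUnit_mul_self L) v 1 hT₁ hJD₁ h)
  {V : Type*} [AddCommGroup V] [Module ℂ V]
  (σ : UnitaryGroup.localPi L (IsCMField.complexConj L) (1 + 1) JD₁ v → V →ₗ[ℂ] V) (lam : V →ₗ[ℂ] ℂ) (Φ : V) (r : ℝ)

include hT₁d hJ₁ hP in
/-- **(O2) THE DOCK, CM SETTING** (`F = L⁺`, `E = L`, `c = c̄`, `δ = imagUnit L`; `v` non-split, `U(W)(L⁺_v) = L_v¹` compact): NO measure-theoretic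
binder — the Haar measure is Mathlib's `Measure.haar` on the borelized `G₁`, right invariant by ★ `isMulRightInvariant_localPi_gramD_one`, and
`[LocallyCompactSpace ↥P]` is discharged by ★ `locallyCompactSpace_of_isSiegelDelta` (also inside the eigen-law binder, where `Δ_P` is read).  For
`σ` multiplicative, `lam` a `Δ_P`-eigenfunctional with continuous coefficients, `Φ` `inl U(W)`-fixed with `lam Φ = r > 0`:
**`∃ Λ : V →ₗ[ℂ] ℂ, (∀ g Ψ, Λ (σ g Ψ) = Λ Ψ) ∧ 0 < re (Λ Φ)`**.  This is the functional that the kernel lemmas ★ (S1)∕(S2) annihilate in the (π3)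
assembly. [cite: WeilIntegration1965, §9] [cite: GelbartPiatetskishapiroRallis1987, Part A §2 Lemma 2.1 p. 8] [cite: Rogawski1990, §4.9 p. 54] -/
theorem exists_invariant_functional_of_fixedVector_cm (hE : IsField (LocalRing L v))
    [CompactSpace (UnitaryGroup.localPi L (IsCMField.complexConj L) 1 J₁ v)]
    (hσ : ∀ g h Ψ, σ (g * h) Ψ = σ g (σ h Ψ))
    (hlam : ∀ (p : P) (Ψ : V),
      (haveI := locallyCompactSpace_of_isSiegelDelta (↥(maximalRealSubfield L)) L (IsCMField.complexConj L)
        (complexConj_imagUnit L) (imagUnit_ne_zero L) (imagUnit_mul_self L) v 1 hT₁ hJD₁ P hP;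
      lam (σ p Ψ) = ((modularCharacter p : ℝ) : ℂ) * lam Ψ))
    (hcont : ∀ Ψ, Continuous fun h => lam (σ h Ψ))
    (hfix : ∀ u, σ (inlLoc (↥(maximalRealSubfield L)) L (IsCMField.complexConj L) v 1 hJ₁ hJD₁ u) Φ = Φ)
    (hΦ : lam Φ = (r : ℂ)) (hr : 0 < r) :
    ∃ Λ : V →ₗ[ℂ] ℂ, (∀ g Ψ, Λ (σ g Ψ) = Λ Ψ) ∧ 0 < (Λ Φ).re := by
  haveI := locallyCompactSpace_of_isSiegelDelta (↥(maximalRealSubfield L)) L (IsCMField.complexConj L)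
    (complexConj_imagUnit L) (imagUnit_ne_zero L) (imagUnit_mul_self L) v 1 hT₁ hJD₁ P hP
  haveI := locallyCompactSpace_localPi L (1 + 1) (IsCMField.complexConj L) JD₁ v
  borelize ↥(UnitaryGroup.localPi L (IsCMField.complexConj L) (1 + 1) JD₁ v)
  haveI := isMulRightInvariant_localPi_gramD_one L v hT₁ hT₁d hJD₁
    (Measure.haar : Measure (UnitaryGroup.localPi L (IsCMField.complexConj L) (1 + 1) JD₁ v))
  exact exists_invariant_functional_of_fixedVector (↥(maximalRealSubfield L)) L (IsCMField.complexConj L)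
    (complexConj_imagUnit L) (imagUnit_ne_zero L) (imagUnit_mul_self L) v hT₁ hT₁d hJ₁ hJD₁ P hP σ lam Φ r hE
    Measure.haar hσ hlam hcont hfix hΦ hr

end CM

end Literature.NumberTheory.GelbartRogawski1991.UnitaryDualPair.LocalSplitting

end
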